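import Summits.QuantumFields.YangMills.Theorems.BalabanUVNodesN09HierarchyBindersOfLevelwiseThm1

/-!
# NODE N09 [B12] — THE NUMERICS LEDGER OF THE REDUCED N09 DOORS: the letters of `…N09OnDomainsDoorOfLevelwiseThm1` §2 are JOINTLY SATISFIABLE iff (essentially) `2B₃ ≤ L`;
# the `εreg`-side nesting (via `hreg8`) lowers the price to print's `2B₃ ≤ L²`

Cell `pub-ymgap` (YM-PLAN Track A, node N09 of 28), width seat `pub-ymgap-dag-n09-w1` (generation 7), FILE 3 — the A6 ∕ numerics sequel of FILE 1 `…N09HierarchyBindersOfLevelwiseThm1`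
(p640069) and FILE 2 `…N09OnDomainsDoorOfLevelwiseThm1` (this seat, same generation): helper of K1⁹ `StabilityBRunRowsAtRecordR13SepCoPHV` = stmt-QuantumFields-27364 (`--supports`,
`--as helper`, count-neutral).  [I] = [Balaban1987RG1] (CMP 109), [B7] = [Balaban1985Averaging] (CMP 98), [B11] = [Balaban1985Variational] (CMP 102).  Imports FILE 1 only.
THEOREMS ONLY (0 `def`, 0 `instance`, 0 `notation`, 0 `sorry`).

WHY.  After FILE 2 §2 the [B11] ∕ two-radii face of N09's on-domains door is {level-wise `h11`, N07's object slots `hT1`∕`hUk`} + NUMERICS LETTERS in the four reals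
`(εbg, εreg, ε₀, ε₂₉) = (θ.εbg, θ.ν.εreg, θ.ν.ε₀, θ.ε₂₉)`: `εreg ≤ εbg`, `0 < ε₂₉`, `0 < εbg`, (53) at `εbg` (`C₀(d)εbg ≤ ⅓`, `2εbg ≤ c′₂ = 2δ_N∕((d+4)L)²`), the nesting letter
`2εbg ≤ ε₀L²`, `0 ≤ B₃`, `0 < ε₀ ≤ a₁`, `B₃ε₀ ≤ εreg` (g2 FILE 3's `hreg8` road), `0 < εreg`, `2εreg ≤ a₁`, `2B₃εreg ≤ εbg ≤ a₀` (FILE 1 §4).  A6 (director-ym №189): is this range EMPTY?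
* §1 ★★ `reducedDoor_numerics_inhabited`: NO — for any constants `0 < a₀`, `0 < a₁`, `½ ≤ B₃` of [B11] Thm 1 and ANY four-torus family with **`2B₃ ≤ L`** the whole list is satisfied at
  `εbg := min(a₀, 1∕(3C₀), c′₂∕2, B₃a₁)`, `εreg := εbg∕(2B₃)`, `ε₀ := εreg∕B₃`, `ε₂₉ := 1`, uniformly in the torus `K` (`(F.P K).d = 4`, `(F.P K).L = F.L`).
* §2 ★★ `two_mul_B₃_le_L_of_letters`: AND THE PRICE IS REAL — the three letters `B₃ε₀ ≤ εreg`, `2B₃εreg ≤ εbg`, `2εbg ≤ ε₀L²` with `0 < εbg`, `0 < B₃` FORCE `2B₃ ≤ L` (chain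
  `2εbg ≤ ε₀L² ≤ εreg L²∕B₃ ≤ εbg L²∕(2B₃²)`).  Print pays `2B₃ ≤ L²` only (one background radius `εbg ∈ [B₃ε₀, a₀]` and the nesting letter): the extra factor is the two-radii bookkeeping
  of FILE 1 §4 when the nesting is read at `εbg` (this seat's g2 FILE 5 `iterUk_mem_domAlt_of_ukExists`).
* §3 THE `εreg`-SIDE NESTING REMOVES THE SURCHARGE: ★ `iterUk_mem_domAlt_of_reg8` ∕ `iterUk_succ_mem_domAlt_of_reg8` — the averaged data `Ū^{j}(U_k V)`, `j < k` (resp. `Ū^{j+1}`,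
  `j < k`) stay in the small-field domains as soon as the background of record is `εreg`-regular (`hreg8`) and (53) holds AT `εreg` with the nesting letter `2εreg ≤ ε₀L²` — dag-n21-c's
  `plaqSmall_iter_avOfRecord_level` read at the class `bgReg_k(εreg)` instead of `bgReg_k(εbg)`; ★★ `huniq_of_h11_of_reg8` ∕ `hsolH_of_hsol_of_reg8` — FILE 1 §3 re-run on it; ★★
  `reducedDoor_numerics_reg8_inhabited` — the `εreg`-side letter set {`0 < εreg`, (53) at `εreg`, `2εreg ≤ ε₀L²`, `0 < ε₀ ≤ a₁`, `B₃ε₀ ≤ εreg`, `2εreg ≤ a₁`, `2B₃εreg ≤ εbg`, `εreg ≤ εbg ≤ a₀`,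
  `0 < ε₂₉`} is inhabited under print's **`2B₃ ≤ L²`** (`½ ≤ B₃`), and ★ `two_mul_B₃_le_L_sq_of_letters` — that price, too, is forced.
So a consumer who wants the reduced door WITHOUT the `L ≥ 2B₃` surcharge re-derives its `huniq`∕nesting through §3 (the (53)-letters move from `εbg` to `εreg`); dag-n09-w2's v1.2 door itself
reads (53) at `εbg` internally (its `hnestreg` derivation), so the surcharge-free edition of THAT door is a re-derivation in dag-n09-w2's lane, not a corollary here (located, not done).

HONEST FRAMING — what this is NOT.  Count-neutral real-arithmetic bookkeeping + one [B7] (53) reading BY NAME; NO constant of Bałaban's is evaluated or asserted (`a₀`, `a₁`, `B₃`, `L` stay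
letters; «L large», «ε small» are print's standing words, [I] p. 251, [B11] Thm 1 p. 279); NOTHING of [B11] is proved; N09 NOT discharged; conjunct 1 (Lemma 4) ∕ FLAG №7 untouched;
K0⁷ ∕ K1⁹ ∕ K3⁸ NOT closed; counts unmoved (typed 28∕28 · discharged 5∕28); no summit statement is proved by this seat; one finite four-torus programme at fixed `ε = L^{−K}` per run — R4 closes
the conditional rung `BalabanLadder.UV` only; NOT continuum ∕ ℝ⁴ ∕ infinite volume ∕ OS; the Yang–Mills mass gap (Clay) is NOT proved by any of this.
-/

noncomputable section

namespace Summit.QuantumFields.YangMills.BalabanUVNodes.N09ReducedDoorNumericsLedger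

open Literature.MathematicalPhysics.QuantumFieldTheory.Balaban1983to89
open Literature.MathematicalPhysics.QuantumFieldTheory.Balaban1983to89.T4Continuum (T4Family)
open Literature.MathematicalPhysics.QuantumFieldTheory.Balaban1983to89.Node00
open Literature.MathematicalPhysics.QuantumFieldTheory.Balaban1983to89.ExpMeanLog (deltaSU deltaSU_pos)
open Summit.QuantumFields.YangMills.BalabanUVNodes.N09NestingOfHierAxial (pow_mul_eta_le_inv)
open Summit.QuantumFields.YangMills.BalabanUVNodes.N09HierarchyBindersOfLevelwiseThm1 (iterUk_succ_mem_domAlt_of_ukExists)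
open Summit.QuantumFields.YangMills.Theorems.N21AveragedDatumRegularity (plaqSmall_iter_avOfRecord_level)

variable {F : T4Family} {N : ℕ} [NeZero N]

/-! ## §1  The reduced door's numerics letters are jointly satisfiable under `2B₃ ≤ L` -/

/-- ★★ **THE NUMERICS LETTERS OF THE REDUCED N09 DOOR ARE JOINTLY SATISFIABLE UNDER `2B₃ ≤ L`** (A6 for FILE 2 §2 `…_of_thm1Objects_of_suppPt'`): for [B11]-type constants `0 < a₀`,
`0 < a₁`, `½ ≤ B₃` and a four-torus family with `2B₃ ≤ L`, there are `εbg εreg ε₀ ε₂₉` satisfying — uniformly in the torus `K` and in the verbatim shapes of the doors — `εreg ≤ εbg`,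
`0 < ε₂₉`, `0 < εbg`, (53) at `εbg`, `2εbg ≤ ε₀L²`, `0 < ε₀ ≤ a₁`, `B₃ε₀ ≤ εreg`, `0 < εreg`, `2εreg ≤ a₁`, `2B₃εreg ≤ εbg ≤ a₀`.  Witness: `εbg = min(a₀, 1∕(3C₀), c′₂∕2, B₃a₁)`,
`εreg = εbg∕(2B₃)`, `ε₀ = εreg∕B₃`, `ε₂₉ = 1`.  Nothing of Bałaban's evaluated. [cite: Balaban1985Variational, Thm 1 p.279 (bookkeeping); Balaban1985Averaging, Prop. 2 (52)–(53) p.26; Balaban1987RG1, (0.1) p.251] -/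
theorem reducedDoor_numerics_inhabited (F : T4Family) (N : ℕ) [NeZero N] {a₀ a₁ B₃ : ℝ} (ha₀ : 0 < a₀) (ha₁ : 0 < a₁) (hB₃ : 1 / 2 ≤ B₃)
    (hL : 2 * B₃ ≤ (F.L : ℝ)) :
    ∃ εbg εreg ε₀ ε₂₉ : ℝ, εreg ≤ εbg ∧ 0 < ε₂₉ ∧ 0 < εbg ∧
      (∀ K : ℕ, (143 * (((((F.P K).d + 4 : ℕ) : ℝ)) ^ 2 / 4) ^ 2) * εbg ≤ 1 / 3) ∧
      (∀ K : ℕ, 2 * εbg ≤ 2 * deltaSU (Fin N) / ((((F.P K).d + 4) * (F.P K).L : ℕ) : ℝ) ^ 2) ∧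
      (∀ K : ℕ, 2 * εbg ≤ ε₀ * ((F.P K).L : ℝ) ^ 2) ∧
      0 < ε₀ ∧ ε₀ ≤ a₁ ∧ B₃ * ε₀ ≤ εreg ∧ 0 < εreg ∧ 2 * εreg ≤ a₁ ∧ 2 * B₃ * εreg ≤ εbg ∧ εbg ≤ a₀ := by
  have hB0 : 0 < B₃ := by linarith
  have hL0 : (0 : ℝ) < F.L := by exact_mod_cast F.hL.2.le.trans_lt' (by norm_num)
  set C₀ : ℝ := 143 * ((((4 + 4 : ℕ) : ℝ)) ^ 2 / 4) ^ 2 with hC₀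
  set c₂ : ℝ := 2 * deltaSU (Fin N) / ((((4 + 4) * F.L : ℕ) : ℝ)) ^ 2 with hc₂
  have hC₀pos : 0 < C₀ := by positivity
  have hLn : 0 < F.L := by have := F.hL.2; omega
  have hc₂pos : 0 < c₂ := by
    have hδ : 0 < deltaSU (Fin N) := deltaSU_pos
    have : (0 : ℝ) < (((4 + 4) * F.L : ℕ) : ℝ) := Nat.cast_pos.2 (Nat.mul_pos (by norm_num) hLn)
    positivity
  set εbg : ℝ := min a₀ (min (1 / (3 * C₀)) (min (c₂ / 2) (B₃ * a₁))) with hεbg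
  have hεpos : 0 < εbg := lt_min ha₀ (lt_min (by positivity) (lt_min (by positivity) (by positivity)))
  have h1 : εbg ≤ a₀ := min_le_left _ _
  have h2 : εbg ≤ 1 / (3 * C₀) := (min_le_right _ _).trans (min_le_left _ _)
  have h3 : εbg ≤ c₂ / 2 := (min_le_right _ _).trans ((min_le_right _ _).trans (min_le_left _ _))
  have h4 : εbg ≤ B₃ * a₁ := (min_le_right _ _).trans ((min_le_right _ _).trans (min_le_right _ _))
  refine ⟨εbg, εbg / (2 * B₃), εbg / (2 * B₃) / B₃, 1, ?_, one_pos, hεpos, ?_, ?_, ?_, by positivity, ?_, ?_, by positivity, ?_, ?_, h1⟩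
  · rw [div_le_iff₀ (by positivity)]; nlinarith
  · intro K
    simp only [T4Family.P_d]
    calc C₀ * εbg ≤ C₀ * (1 / (3 * C₀)) := mul_le_mul_of_nonneg_left h2 hC₀pos.le
      _ = 1 / 3 := by field_simp
  · intro K
    simp only [T4Family.P_d, T4Family.P_L]
    linarith
  · intro K
    simp only [T4Family.P_L]
    have hsq : 4 * B₃ ^ 2 ≤ (F.L : ℝ) ^ 2 := by nlinarith
    rw [div_div, show 2 * B₃ * B₃ = 2 * B₃ ^ 2 by ring]
    rw [show εbg / (2 * B₃ ^ 2) * (F.L : ℝ) ^ 2 = εbg * ((F.L : ℝ) ^ 2 / (2 * B₃ ^ 2)) by ring]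
    have h2le : (2 : ℝ) ≤ (F.L : ℝ) ^ 2 / (2 * B₃ ^ 2) := by
      rw [le_div_iff₀ (by positivity)]; linarith
    calc 2 * εbg = εbg * 2 := mul_comm _ _
      _ ≤ εbg * ((F.L : ℝ) ^ 2 / (2 * B₃ ^ 2)) := mul_le_mul_of_nonneg_left h2le hεpos.le
  · -- `ε₀ ≤ a₁`
    rw [div_div, div_le_iff₀ (by positivity)]
    nlinarith
  · -- `B₃ ε₀ ≤ εreg`
    rw [mul_div_cancel₀ _ hB0.ne']
  · -- `2 εreg ≤ a₁`
    rw [show 2 * (εbg / (2 * B₃)) = εbg / B₃ by field_simp]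
    rw [div_le_iff₀ hB0]
    linarith
  · -- `2 B₃ εreg ≤ εbg`
    rw [show 2 * B₃ * (εbg / (2 * B₃)) = εbg by field_simp]

/-! ## §2  … and the price `2B₃ ≤ L` is forced by three of the letters -/

/-- ★★ **THE TWO-RADII LETTERS FORCE `2B₃ ≤ L`**: `B₃ε₀ ≤ εreg`, `2B₃εreg ≤ εbg` and the nesting letter `2εbg ≤ ε₀L²`, with `0 < εbg`, `0 < B₃`, `0 ≤ L`, give `2B₃ ≤ L`
(`2εbg ≤ ε₀L² ≤ εregL²∕B₃ ≤ εbgL²∕(2B₃²)`, so `4B₃² ≤ L²`).  Print's single-radius bookkeeping (`εbg ∈ [B₃ε₀, a₀]` + nesting) forces only `2B₃ ≤ L²`: the extra factor is the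
surcharge of reading (53) at `εbg` in FILE 1 §3; §3 below removes it. [cite: Balaban1985Variational, Thm 1 (8) p.279 (bookkeeping); Balaban1985Averaging, Prop. 2 (53) p.26] -/
theorem two_mul_B₃_le_L_of_letters {εbg εreg ε₀ B₃ L : ℝ} (hεbg : 0 < εbg) (hB₃ : 0 < B₃) (hL : 0 ≤ L)
    (hB₀ : B₃ * ε₀ ≤ εreg) (hB : 2 * B₃ * εreg ≤ εbg) (hnest : 2 * εbg ≤ ε₀ * L ^ 2) : 2 * B₃ ≤ L := by
  have hε₀ : ε₀ ≤ εbg / (2 * B₃ ^ 2) := by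
    rw [le_div_iff₀ (by positivity)]
    nlinarith
  have hB2 : (2 : ℝ) * B₃ ^ 2 ≠ 0 := by positivity
  have hsq : 4 * B₃ ^ 2 ≤ L ^ 2 := by
    have h1 : 2 * εbg ≤ εbg / (2 * B₃ ^ 2) * L ^ 2 := hnest.trans (mul_le_mul_of_nonneg_right hε₀ (sq_nonneg _))
    have h2 : 2 * εbg * (2 * B₃ ^ 2) ≤ εbg * L ^ 2 := by
      have h3 := mul_le_mul_of_nonneg_right h1 (show (0 : ℝ) ≤ 2 * B₃ ^ 2 by positivity)
      have h4 : εbg / (2 * B₃ ^ 2) * L ^ 2 * (2 * B₃ ^ 2) = εbg * L ^ 2 := by field_simp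
      linarith
    nlinarith
  by_contra hlt
  have hlt' : L < 2 * B₃ := lt_of_not_ge hlt
  have : L ^ 2 < (2 * B₃) ^ 2 := pow_lt_pow_left₀ hlt' hL two_ne_zero
  nlinarith

/-! ## §3  The `εreg`-side nesting: (53) read at the class `bgReg_k(εreg)` of the background of record (`hreg8`) -/

/-- ★ **NESTING FROM `hreg8`**: if the radius-`εbg` background of record of `V` is `εreg`-regular (`U_k(V) ∈ bgReg_k(εreg)`) and (53) holds AT `εreg` with the nesting letter `2εreg ≤ ν.ε₀L²`,
then `Ū^{j}(U_k V) ∈ domAlt_j` for every `j < k` — dag-n21-c's `plaqSmall_iter_avOfRecord_level` at `α₀ := εreg` and `L^jη_k ≤ L⁻¹` (g2 `pow_mul_eta_le_inv`).  No letter at `εbg`.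
[cite: Balaban1985Averaging, Prop. 2 (53) p.26; Balaban1987RG1, (1.2) p.260 and p.259] -/
theorem iterUk_mem_domAlt_of_reg8 (ν : Stage7Numerics) {εbg : ℝ} {K k : ℕ} (hεreg : 0 < ν.εreg)
    (hr3 : (143 * (((((F.P K).d + 4 : ℕ) : ℝ)) ^ 2 / 4) ^ 2) * ν.εreg ≤ 1 / 3)
    (hr2 : 2 * ν.εreg ≤ 2 * deltaSU (Fin N) / ((((F.P K).d + 4) * (F.P K).L : ℕ) : ℝ) ^ 2) (hr0 : 2 * ν.εreg ≤ ν.ε₀ * ((F.P K).L : ℝ) ^ 2)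
    {V : GaugeField (F.P K) k (SU N)} (hU₀ : Uk F N K k εbg V ∈ bgReg F N K k ν.εreg) {j : ℕ} (hj : j < k) :
    Averaging.iter (avOfRecord F N K) j (Uk F N K k εbg V) ∈ domAltOfRecord F N ν K j := by
  rw [mem_domAltOfRecord_iff]
  have h := plaqSmall_iter_avOfRecord_level K k hεreg hr3 hr2 ((mem_bgReg_iff F N K k _ _).1 hU₀) hj.le
  have hL0 : (0 : ℝ) < (F.P K).L := by exact_mod_cast (F.P K).L_pos
  have hη0 : 0 ≤ ((F.P K).L : ℝ) ^ j * (F.P K).eta k := by unfold Params.eta; positivity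
  have hsq : (((F.P K).L : ℝ) ^ j * (F.P K).eta k) ^ 2 ≤ (((F.P K).L : ℝ)⁻¹) ^ 2 := pow_le_pow_left₀ hη0 (pow_mul_eta_le_inv hj) 2
  have hbound : 2 * ν.εreg * (((F.P K).L : ℝ) ^ j * (F.P K).eta k) ^ 2 ≤ ν.ε₀ := by
    calc 2 * ν.εreg * (((F.P K).L : ℝ) ^ j * (F.P K).eta k) ^ 2 ≤ 2 * ν.εreg * (((F.P K).L : ℝ)⁻¹) ^ 2 := by gcongr
      _ = 2 * ν.εreg / ((F.P K).L : ℝ) ^ 2 := by rw [inv_pow, div_eq_mul_inv]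
      _ ≤ ν.ε₀ := by rw [div_le_iff₀ (by positivity)]; exact hr0
  exact fun p => (h p).trans_le hbound

/-- ★ **NESTING FROM `hreg8`, level `j+1 ≤ k`** (the top level `j+1 = k` is `Node00.iter_Uk` at the solvable datum `V ∈ domAlt_k`). [cite: Balaban1985Averaging, Prop. 2 (53) p.26; Balaban1987RG1, (0.21) p.256] -/
theorem iterUk_succ_mem_domAlt_of_reg8 (ν : Stage7Numerics) {εbg : ℝ} {K k : ℕ} (hεreg : 0 < ν.εreg)
    (hr3 : (143 * (((((F.P K).d + 4 : ℕ) : ℝ)) ^ 2 / 4) ^ 2) * ν.εreg ≤ 1 / 3)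
    (hr2 : 2 * ν.εreg ≤ 2 * deltaSU (Fin N) / ((((F.P K).d + 4) * (F.P K).L : ℕ) : ℝ) ^ 2) (hr0 : 2 * ν.εreg ≤ ν.ε₀ * ((F.P K).L : ℝ) ^ 2)
    {V : GaugeField (F.P K) k (SU N)} (hV : V ∈ domAltOfRecord F N ν K k) (hex : UkExists F N K k εbg V) (hU₀ : Uk F N K k εbg V ∈ bgReg F N K k ν.εreg)
    {j : ℕ} (hj : j < k) :
    Averaging.iter (avOfRecord F N K) (j + 1) (Uk F N K k εbg V) ∈ domAltOfRecord F N ν K (j + 1) := by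
  rcases (Nat.succ_le_of_lt hj).eq_or_lt with h | h
  · subst h
    rw [iter_Uk hex]
    exact hV
  · exact iterUk_mem_domAlt_of_reg8 ν hεreg hr3 hr2 hr0 hU₀ h

/-- ★★ **`hsolH` FROM `hsol`, `εreg`-SIDE NUMERICS** (FILE 1 `hsolH_of_hsol` with the nesting read through `hreg8`). [cite: Balaban1985Averaging, Prop. 2 (53) p.26; Balaban1985Variational, Thm 1 p.279] -/
theorem hsolH_of_hsol_of_reg8 (ν : Stage7Numerics) {εbg : ℝ} {K : ℕ} (hεreg : 0 < ν.εreg)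
    (hr3 : (143 * (((((F.P K).d + 4 : ℕ) : ℝ)) ^ 2 / 4) ^ 2) * ν.εreg ≤ 1 / 3)
    (hr2 : 2 * ν.εreg ≤ 2 * deltaSU (Fin N) / ((((F.P K).d + 4) * (F.P K).L : ℕ) : ℝ) ^ 2) (hr0 : 2 * ν.εreg ≤ ν.ε₀ * ((F.P K).L : ℝ) ^ 2)
    (hreg8 : ∀ k, k ≤ K → ∀ V ∈ domAltOfRecord F N ν K k, Uk F N K k εbg V ∈ bgReg F N K k ν.εreg)
    (hsol : ∀ k, k ≤ K → ∀ V ∈ domAltOfRecord F N ν K k, UkExists F N K k εbg V) :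
    ∀ k, k ≤ K → ∀ V ∈ domAltOfRecord F N ν K k, ∀ j < k,
      UkExists F N K (j + 1) εbg (Averaging.iter (avOfRecord F N K) (j + 1) (Uk F N K k εbg V)) :=
  fun k hk V hV j hj => hsol (j + 1) (by omega) _
    (iterUk_succ_mem_domAlt_of_reg8 ν hεreg hr3 hr2 hr0 hV (hsol k hk V hV) (hreg8 k hk V hV) hj)

/-- ★★ **`huniq` FROM THE LEVEL-WISE `h11`, `εreg`-SIDE NUMERICS** (FILE 1 `huniq_of_h11` with the nesting read through `hreg8`: (53) at `εreg`, `2εreg ≤ ν.ε₀L²`; no letter at `εbg`).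
CONDITIONAL on `h11` (N07) and `hreg8`; nothing of Bałaban's asserted. [cite: Balaban1985Variational, Thm 1 (6) and (8) p.279; Balaban1985Averaging, Prop. 2 (53) p.26; Balaban1987RG1, (1.1)–(1.2) p.260] -/
theorem huniq_of_h11_of_reg8 (ν : Stage7Numerics) {εbg : ℝ} {K : ℕ} (hεreg : 0 < ν.εreg)
    (hr3 : (143 * (((((F.P K).d + 4 : ℕ) : ℝ)) ^ 2 / 4) ^ 2) * ν.εreg ≤ 1 / 3)
    (hr2 : 2 * ν.εreg ≤ 2 * deltaSU (Fin N) / ((((F.P K).d + 4) * (F.P K).L : ℕ) : ℝ) ^ 2) (hr0 : 2 * ν.εreg ≤ ν.ε₀ * ((F.P K).L : ℝ) ^ 2)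
    (hreg8 : ∀ k, k ≤ K → ∀ V ∈ domAltOfRecord F N ν K k, Uk F N K k εbg V ∈ bgReg F N K k ν.εreg)
    (h11 : ∀ k, k ≤ K → ∀ V ∈ domAltOfRecord F N ν K k, UkExists F N K k εbg V ∧ UniqueUkOrbit F N K k εbg V) :
    ∀ k, k ≤ K → ∀ V ∈ domAltOfRecord F N ν K k, ∀ j < k,
      UniqueUkOrbit F N K (j + 1) εbg (Averaging.iter (avOfRecord F N K) (j + 1) (Uk F N K k εbg V)) :=
  fun k hk V hV j hj => (h11 (j + 1) (by omega) _
    (iterUk_succ_mem_domAlt_of_reg8 ν hεreg hr3 hr2 hr0 hV (h11 k hk V hV).1 (hreg8 k hk V hV) hj)).2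

/-- ★★ **THE `εreg`-SIDE LETTER SET IS INHABITED UNDER PRINT's `2B₃ ≤ L²`** (`0 < a₀`, `0 < a₁`, `½ ≤ B₃`): `0 < εreg`, (53) at `εreg`, `2εreg ≤ ε₀L²`, `0 < ε₀ ≤ a₁`, `B₃ε₀ ≤ εreg`,
`2εreg ≤ a₁`, `2B₃εreg ≤ εbg`, `εreg ≤ εbg ≤ a₀`, `0 < ε₂₉`, uniformly in `K`.  Witness: `εreg = min(a₀∕(2B₃), 1∕(3C₀), c′₂∕2, a₁∕2)`, `εbg = 2B₃εreg`, `ε₀ = εreg∕B₃`, `ε₂₉ = 1`.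
[cite: Balaban1985Variational, Thm 1 p.279 (bookkeeping); Balaban1985Averaging, Prop. 2 (52)–(53) p.26; Balaban1987RG1, (0.1) p.251] -/
theorem reducedDoor_numerics_reg8_inhabited (F : T4Family) (N : ℕ) [NeZero N] {a₀ a₁ B₃ : ℝ} (ha₀ : 0 < a₀) (ha₁ : 0 < a₁) (hB₃ : 1 / 2 ≤ B₃)
    (hL : 2 * B₃ ≤ (F.L : ℝ) ^ 2) :
    ∃ εbg εreg ε₀ ε₂₉ : ℝ, 0 < εreg ∧
      (∀ K : ℕ, (143 * (((((F.P K).d + 4 : ℕ) : ℝ)) ^ 2 / 4) ^ 2) * εreg ≤ 1 / 3) ∧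
      (∀ K : ℕ, 2 * εreg ≤ 2 * deltaSU (Fin N) / ((((F.P K).d + 4) * (F.P K).L : ℕ) : ℝ) ^ 2) ∧
      (∀ K : ℕ, 2 * εreg ≤ ε₀ * ((F.P K).L : ℝ) ^ 2) ∧
      0 < ε₀ ∧ ε₀ ≤ a₁ ∧ B₃ * ε₀ ≤ εreg ∧ 2 * εreg ≤ a₁ ∧ 2 * B₃ * εreg ≤ εbg ∧ εreg ≤ εbg ∧ εbg ≤ a₀ ∧ 0 < ε₂₉ := by
  have hB0 : 0 < B₃ := by linarith
  have hL0 : (0 : ℝ) < F.L := by exact_mod_cast F.hL.2.le.trans_lt' (by norm_num)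
  set C₀ : ℝ := 143 * ((((4 + 4 : ℕ) : ℝ)) ^ 2 / 4) ^ 2 with hC₀
  set c₂ : ℝ := 2 * deltaSU (Fin N) / ((((4 + 4) * F.L : ℕ) : ℝ)) ^ 2 with hc₂
  have hC₀pos : 0 < C₀ := by positivity
  have hLn : 0 < F.L := by have := F.hL.2; omega
  have hc₂pos : 0 < c₂ := by
    have hδ : 0 < deltaSU (Fin N) := deltaSU_pos
    have : (0 : ℝ) < (((4 + 4) * F.L : ℕ) : ℝ) := Nat.cast_pos.2 (Nat.mul_pos (by norm_num) hLn)
    positivity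
  set εreg : ℝ := min (a₀ / (2 * B₃)) (min (1 / (3 * C₀)) (min (c₂ / 2) (a₁ / 2))) with hεreg
  have hεpos : 0 < εreg := lt_min (by positivity) (lt_min (by positivity) (lt_min (by positivity) (by positivity)))
  have h1 : εreg ≤ a₀ / (2 * B₃) := min_le_left _ _
  have h2 : εreg ≤ 1 / (3 * C₀) := (min_le_right _ _).trans (min_le_left _ _)
  have h3 : εreg ≤ c₂ / 2 := (min_le_right _ _).trans ((min_le_right _ _).trans (min_le_left _ _))
  have h4 : εreg ≤ a₁ / 2 := (min_le_right _ _).trans ((min_le_right _ _).trans (min_le_right _ _))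
  refine ⟨2 * B₃ * εreg, εreg, εreg / B₃, 1, hεpos, ?_, ?_, ?_, by positivity, ?_, ?_, by linarith, le_rfl, by nlinarith, ?_, one_pos⟩
  · intro K
    simp only [T4Family.P_d]
    calc C₀ * εreg ≤ C₀ * (1 / (3 * C₀)) := mul_le_mul_of_nonneg_left h2 hC₀pos.le
      _ = 1 / 3 := by field_simp
  · intro K
    simp only [T4Family.P_d, T4Family.P_L]
    linarith
  · intro K
    simp only [T4Family.P_L]
    rw [show εreg / B₃ * (F.L : ℝ) ^ 2 = εreg * ((F.L : ℝ) ^ 2 / B₃) by ring]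
    have h2le : (2 : ℝ) ≤ (F.L : ℝ) ^ 2 / B₃ := by rw [le_div_iff₀ hB0]; linarith
    calc 2 * εreg = εreg * 2 := mul_comm _ _
      _ ≤ εreg * ((F.L : ℝ) ^ 2 / B₃) := mul_le_mul_of_nonneg_left h2le hεpos.le
  · rw [div_le_iff₀ hB0]; nlinarith
  · rw [mul_div_cancel₀ _ hB0.ne']
  · calc 2 * B₃ * εreg ≤ 2 * B₃ * (a₀ / (2 * B₃)) := mul_le_mul_of_nonneg_left h1 (by positivity)
      _ = a₀ := by field_simp

/-- ★ **… AND `2B₃ ≤ L²` IS FORCED** by `B₃ε₀ ≤ εreg` and the `εreg`-side nesting letter `2εreg ≤ ε₀L²` (`0 < εreg`): print's price exactly.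
[cite: Balaban1985Variational, Thm 1 (8) p.279 (bookkeeping); Balaban1985Averaging, Prop. 2 (53) p.26] -/
theorem two_mul_B₃_le_L_sq_of_letters {εreg ε₀ B₃ L : ℝ} (hεreg : 0 < εreg) (hB₀ : B₃ * ε₀ ≤ εreg) (hnest : 2 * εreg ≤ ε₀ * L ^ 2) :
    2 * B₃ ≤ L ^ 2 := by
  have hε₀ : 0 < ε₀ := by nlinarith [sq_nonneg L]
  nlinarith [sq_nonneg L, mul_nonneg hε₀.le (sq_nonneg L)]

end Summit.QuantumFields.YangMills.BalabanUVNodes.N09ReducedDoorNumericsLedger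

end
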